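import Literature.RingTheory.MvPolynomial.NuInvariant
import HarnessLib

/-!
# Invariance of the `ν*`-invariant under graded automorphisms and change of the base field
# (Cossart–Jannsen–Saito 2020, Def. 2.1, Lemma 2.6, Rem. 2.9)

Topic: `Literature/RingTheory/MvPolynomial`. CJS, LNM 2270, §2.1: the `ν`-invariant `ν*(I)` of a
homogeneous ideal `I ⊆ k[X_1, …, X_n]` (Def. 2.1, `nuInv` of `NuInvariant.lean`) is an invariant of
the graded algebra `S/I` (Rem. 2.9 (b): "for any standard graded `k`-algebra `A` … we may define
its absolute `ν`-invariant by `ν*(A) = ν*(ker(α_A))`") and does not change under extension of the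
base field (Lemma 2.6: "`ν*(I) = ν*(I_K)`"). PROVED here:

* `NuCondition.map_algEquiv`, **`nuInv_map_algEquiv`** — `ν*(θ I) = ν*(I)` for a `k`-algebra
  automorphism `θ` of `S` preserving degrees (e.g. a linear change of coordinates);
* `NuCondition.map_of_bijective`, **`nuInv_map_of_bijective`** — `ν*(I · K[X]) = ν*(I)` for an
  ISOMORPHISM `κ : k → K` of fields (the case of Lemma 2.6 needed to identify residue fields;
  the general field extension `K/k` of Lemma 2.6 needs `(I_K)_μ = I_μ ⊗ K`, see
  `HilbertFunctionBaseChange.lean`, and is not treated here).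

## References

* V. Cossart, U. Jannsen, S. Saito, *Desingularization: Invariants and Strategy*, LNM 2270
  (2020), Ch. 2, Def. 2.1, Lemma 2.6, Rem. 2.9 (b). [CossartJannsenSaito2020]
-/

noncomputable section

open MvPolynomial

namespace Literature.RingTheory.MvPolynomial

variable {K : Type*} [Field K] {n : ℕ}

/-! ## Graded automorphisms -/

section AlgEquiv

variable (θ : MvPolynomial (Fin n) K ≃ₐ[K] MvPolynomial (Fin n) K)
  (hθ : ∀ (d : ℕ) (f : MvPolynomial (Fin n) K), f.IsHomogeneous d → (θ f).IsHomogeneous d)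
  (hθ' : ∀ (d : ℕ) (f : MvPolynomial (Fin n) K), f.IsHomogeneous d → (θ.symm f).IsHomogeneous d)

include hθ hθ' in
/-- **The degree-`μ` part of `θ I` is `θ(I_μ)`** for a degree-preserving automorphism `θ`. [folklore] -/
theorem mem_idealDegree_map_algEquiv_iff (I : Ideal (MvPolynomial (Fin n) K)) (μ : ℕ)
    (f : MvPolynomial (Fin n) K) :
    f ∈ idealDegree (I.map (θ : MvPolynomial (Fin n) K →+* MvPolynomial (Fin n) K)) μ ↔
      θ.symm f ∈ idealDegree I μ := by
  have hmap : ∀ g, g ∈ I.map (θ : MvPolynomial (Fin n) K →+* MvPolynomial (Fin n) K) ↔ θ.symm g ∈ I := by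
    intro g
    rw [Ideal.mem_map_iff_of_surjective (θ : MvPolynomial (Fin n) K →+* MvPolynomial (Fin n) K)
      θ.surjective]
    constructor
    · rintro ⟨x, hx, rfl⟩
      simpa using hx
    · intro h
      exact ⟨θ.symm g, h, θ.apply_symm_apply g⟩
  constructor
  · rintro ⟨hfI, hfμ⟩
    exact ⟨(hmap f).mp hfI, hθ' μ f hfμ⟩
  · rintro ⟨hfI, hfμ⟩
    refine ⟨(hmap f).mpr hfI, ?_⟩
    simpa using hθ μ _ hfμ

include hθ hθ' in
/-- The condition of Def. 2.1 is transported by `θ`. [cite: CossartJannsenSaito2020, Def. 2.1] -/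
theorem NuCondition.map_algEquiv {I : Ideal (MvPolynomial (Fin n) K)} {ν i : ℕ}
    {φ : Fin i → MvPolynomial (Fin n) K} (h : NuCondition I ν φ) :
    NuCondition (I.map (θ : MvPolynomial (Fin n) K →+* MvPolynomial (Fin n) K)) ν (fun j => θ (φ j)) := by
  refine ⟨fun j => ⟨Ideal.mem_map_of_mem _ (h.1 j).1, ?_⟩, fun μ hμ => ?_⟩
  · obtain ⟨d, hd⟩ := (h.1 j).2
    exact ⟨d, hθ d _ hd⟩
  · have hspan : Ideal.span (Set.range fun j => θ (φ j)) =
        (Ideal.span (Set.range φ)).map (θ : MvPolynomial (Fin n) K →+* MvPolynomial (Fin n) K) := by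
      rw [Ideal.map_span, ← Set.range_comp]
      rfl
    ext f
    rw [hspan, mem_idealDegree_map_algEquiv_iff θ hθ hθ', mem_idealDegree_map_algEquiv_iff θ hθ hθ',
      h.2 μ hμ]

include hθ hθ' in
/-- **`ν*(θ I) = ν*(I)`** for a degree-preserving `k`-algebra automorphism `θ` of `k[X_1, …, X_n]`
(CJS Rem. 2.9 (b): `ν*` is an invariant of the graded algebra `S/I`). [cite: CossartJannsenSaito2020, Rem. 2.9 (b)] -/
theorem nuInv_map_algEquiv (I : Ideal (MvPolynomial (Fin n) K)) (i : ℕ) :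
    nuInv (I.map (θ : MvPolynomial (Fin n) K →+* MvPolynomial (Fin n) K)) i = nuInv I i := by
  refine le_antisymm ?_ ?_
  · rw [nuInv_le_iff]
    intro ν φ hφ
    have h := hφ.map_algEquiv θ.symm (fun d f hf => hθ' d f hf)
      (fun d f hf => by simpa using hθ d f hf)
    rw [Ideal.map_map,
      show ((θ.symm : MvPolynomial (Fin n) K →+* MvPolynomial (Fin n) K).comp
        (θ : MvPolynomial (Fin n) K →+* MvPolynomial (Fin n) K)) = RingHom.id _ from
          RingHom.ext fun x => θ.symm_apply_apply x, Ideal.map_id] at h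
    exact le_nuInv h
  · rw [nuInv_le_iff]
    intro ν φ hφ
    exact le_nuInv (hφ.map_algEquiv θ hθ hθ')

end AlgEquiv

/-! ## Isomorphisms of the base field -/

section BaseField

variable {L : Type*} [Field L] (κ : K →+* L) (hκ : Function.Bijective κ)

include hκ in
/-- `map κ` is bijective on polynomials when `κ` is. [folklore] -/
theorem map_bijective_of_bijective : Function.Bijective
    (MvPolynomial.map κ : MvPolynomial (Fin n) K →+* MvPolynomial (Fin n) L) :=
  ⟨MvPolynomial.map_injective κ hκ.1, MvPolynomial.map_surjective κ hκ.2⟩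

include hκ in
/-- Homogeneity is detected after an isomorphic change of coefficients. [folklore] -/
theorem isHomogeneous_of_map_of_bijective {f : MvPolynomial (Fin n) K} {d : ℕ}
    (hf : (MvPolynomial.map κ f).IsHomogeneous d) : f.IsHomogeneous d := by
  intro m hm
  refine hf (d := m) ?_
  rw [coeff_map]
  exact fun h => hm (hκ.1 (by rw [h, map_zero]))

include hκ in
/-- **The degree-`μ` part of `I · L[X]` is the image of `I_μ`** when `κ : K → L` is bijective. [folklore] -/
theorem mem_idealDegree_map_of_bijective_iff (I : Ideal (MvPolynomial (Fin n) K)) (μ : ℕ)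
    (f : MvPolynomial (Fin n) K) :
    MvPolynomial.map κ f ∈ idealDegree (I.map (MvPolynomial.map κ)) μ ↔ f ∈ idealDegree I μ := by
  have hmap : ∀ g : MvPolynomial (Fin n) K,
      MvPolynomial.map κ g ∈ I.map (MvPolynomial.map κ) ↔ g ∈ I := by
    intro g
    rw [Ideal.mem_map_iff_of_surjective _ (map_bijective_of_bijective κ hκ).2]
    constructor
    · rintro ⟨x, hx, hxg⟩
      rwa [← (map_bijective_of_bijective κ hκ).1 hxg]
    · exact fun h => ⟨g, h, rfl⟩
  constructor
  · rintro ⟨hfI, hfμ⟩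
    exact ⟨(hmap f).mp hfI, isHomogeneous_of_map_of_bijective κ hκ hfμ⟩
  · rintro ⟨hfI, hfμ⟩
    exact ⟨(hmap f).mpr hfI, hfμ.map κ⟩

include hκ in
/-- The condition of Def. 2.1 is transported along `κ`. [cite: CossartJannsenSaito2020, Lemma 2.6] -/
theorem NuCondition.map_of_bijective {I : Ideal (MvPolynomial (Fin n) K)} {ν i : ℕ}
    {φ : Fin i → MvPolynomial (Fin n) K} (h : NuCondition I ν φ) :
    NuCondition (I.map (MvPolynomial.map κ)) ν (fun j => MvPolynomial.map κ (φ j)) := by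
  refine ⟨fun j => ⟨Ideal.mem_map_of_mem _ (h.1 j).1, ?_⟩, fun μ hμ => ?_⟩
  · obtain ⟨d, hd⟩ := (h.1 j).2
    exact ⟨d, hd.map κ⟩
  · have hspan : Ideal.span (Set.range fun j => MvPolynomial.map κ (φ j)) =
        (Ideal.span (Set.range φ)).map (MvPolynomial.map κ) := by
      rw [Ideal.map_span, ← Set.range_comp]
      rfl
    ext f
    obtain ⟨f, rfl⟩ := (map_bijective_of_bijective κ hκ).2 f
    rw [hspan, mem_idealDegree_map_of_bijective_iff κ hκ, mem_idealDegree_map_of_bijective_iff κ hκ,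
      h.2 μ hμ]

include hκ in
/-- The condition of Def. 2.1 descends along `κ`. [cite: CossartJannsenSaito2020, Lemma 2.6] -/
theorem NuCondition.of_map_of_bijective {I : Ideal (MvPolynomial (Fin n) K)} {ν i : ℕ}
    {ψ : Fin i → MvPolynomial (Fin n) L} (h : NuCondition (I.map (MvPolynomial.map κ)) ν ψ) :
    ∃ φ : Fin i → MvPolynomial (Fin n) K, NuCondition I ν φ := by
  choose φ hφ using fun j => (map_bijective_of_bijective (n := n) κ hκ).2 (ψ j)
  refine ⟨φ, fun j => ⟨?_, ?_⟩, fun μ hμ => ?_⟩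
  · have h1 := (h.1 j).1
    rw [← hφ j, Ideal.mem_map_iff_of_surjective _ (map_bijective_of_bijective κ hκ).2] at h1
    obtain ⟨g, hg, hgφ⟩ := h1
    rwa [← (map_bijective_of_bijective κ hκ).1 hgφ]
  · obtain ⟨d, hd⟩ := (h.1 j).2
    rw [← hφ j] at hd
    exact ⟨d, isHomogeneous_of_map_of_bijective κ hκ hd⟩
  · have hspan : (Ideal.span (Set.range φ)).map (MvPolynomial.map κ) = Ideal.span (Set.range ψ) := by
      rw [Ideal.map_span, ← Set.range_comp,
        show ((MvPolynomial.map κ : MvPolynomial (Fin n) K →+* MvPolynomial (Fin n) L) ∘ φ) = ψ from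
          funext hφ]
    ext f
    rw [← mem_idealDegree_map_of_bijective_iff κ hκ, ← mem_idealDegree_map_of_bijective_iff κ hκ,
      hspan, h.2 μ hμ]

include hκ in
/-- **`ν*(I · L[X]) = ν*(I)` for an isomorphism `κ : K → L`** (CJS Lemma 2.6 in the case of
isomorphic fields). [cite: CossartJannsenSaito2020, Lemma 2.6] -/
theorem nuInv_map_of_bijective (I : Ideal (MvPolynomial (Fin n) K)) (i : ℕ) :
    nuInv (I.map (MvPolynomial.map κ)) i = nuInv I i := by
  refine le_antisymm ?_ ?_
  · rw [nuInv_le_iff]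
    intro ν ψ hψ
    obtain ⟨φ, hφ⟩ := NuCondition.of_map_of_bijective κ hκ hψ
    exact le_nuInv hφ
  · rw [nuInv_le_iff]
    intro ν φ hφ
    exact le_nuInv (hφ.map_of_bijective κ hκ)

end BaseField

end Literature.RingTheory.MvPolynomial

end
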